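import Literature.Probability.Percolation.KestenScalingFromFacts
import Literature.Probability.Percolation.FourArmPivotalSumWerner
import HarnessLib

/-!
# Kesten's scaling relation `|p - 1/2| · L_ε(p)² · π₄(L_ε(p)) ≍ 1` from four named facts (assembly, proofs only)

Topic `Literature/Probability/Percolation`; family `crit-perc`, statement **crit-perc.S16**
(`Literature.Probability.Percolation.triTheta_exponent`). PROOFS ONLY (no new definition, no new
named fact): the state of the discharge of the named fact `Nolin2008_prop34` (`KestenScaling.lean`;
P. Nolin, *Near-critical percolation in two dimensions*, Electron. J. Probab. 13 (2008), §7.3,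
Prop. 34 [arXiv 0711.4948: Prop. 32]: "for any fixed `ε ∈ (0, 1/2)`,
`|p - 1/2| L(p)² π₄(L(p)) ≍ 1`"; originally H. Kesten, *Comm. Math. Phys.* 109 (1987), (4.5);
W. Werner, *Lectures on two-dimensional critical percolation* (2009), Lecture 6, display after
Lemma 6.3).

`KestenScalingFromFacts.lean` proves `Nolin2008_prop34` from five named facts of Werner's
Lecture 6 (`Nolin2008_prop34_of_wernerFacts`): the four facts of Kesten's near-critical arm
calculus that the tree isolates —

* `Werner2009_fourArm_quasiMult` (Lecture 6, Cor. 6.2; `NearCriticalFourArmFacts.lean`),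
* `Werner2009_fourArm_lowerBound` (Lecture 6, §3, third a priori estimate; ibid.),
* `Werner2009_halfPlane_twoArm` (Lecture 6, §3 ¶1; `NearCriticalBoundaryFacts.lean`),
* `Werner2009_pivotal_lowerBound` (Lecture 6, proof of Lemma 6.2; ibid.) —

and the four-arm stability `Werner2009_lemma63` (Lecture 6, Lemma 6.3; `WernerPivotalEstimates.lean`).
Since `FourArmPivotalSumWerner.lean` the tree derives the fifth from the first four
(`Werner2009_lemma63_of_facts`: Werner's §5 differential inequality
`|d/dp log π̂_p(n)| ≤ c'' d/dp h_p(n)` integrated from `1/2`). Hence (this file)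
`Nolin2008_prop34_of_facts`: **Kesten's relation at Nolin's length `L_ε` follows from exactly the
four named facts above**, with no further input — the same four from which
`WernerKestenRelationFromFacts.lean` obtains the relation at Werner's length
(`Werner2009_kestenRelationW_of_facts`). The discharge `Nolin2008_prop34_holds` is
`Nolin2008_prop34_of_facts` applied to `Werner2009_fourArm_quasiMult_holds`,
`Werner2009_fourArm_lowerBound_holds`, `Werner2009_halfPlane_twoArm_holds` and
`Werner2009_pivotal_lowerBound_holds` once these land (none is in the tree yet); the older
one-hypothesis form `Nolin2008_prop34_of_lemma62` (`KestenScalingProofs.lean`, from the rhombus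
pivotal count `Werner2009_lemma62`) remains available.

Remark on the colour arrangement (recorded for the discharge of the four hypotheses; nothing in
this file depends on it). The four facts are stated for the tree's four-arm probability
`fourArmProbAt t r₀ N = P_t(armEvent ![T,F,T,F] r₀ N)`, in which the cyclic order of the two open
and two closed arms is not imposed (`ArmEvents.lean`, `WernerPivotalEstimates.lean`: alternating
or adjacent arrangement), whereas Werner's `π̂_p` and Nolin's `A_{4,σ₄}` are the alternating
event. A pivotal site of a crossing event carries the alternating arrangement (Nolin 2008, Rem. 9),
and two arm families in nested annuli extend to one only when their arrangements agree; so
`Werner2009_pivotal_lowerBound` and `Werner2009_fourArm_quasiMult`, read for the order-free event,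
include the comparability of the adjacent and the alternating four-arm probabilities below
`L(t, ε)`. In the source this comparability is the conjunction of the colour exchange at `t = 1/2`
(Nolin 2008, Prop. 20 [arXiv: Prop. 19]: `P_{1/2}(A_{j,σ}) ≍ P_{1/2}(A_{j,σ'})` for non-constant
`σ, σ'`, proved with landing sequences) and the near-critical stability of each polychromatic arm
event (Thm. 27 [arXiv: Thm. 26]), i.e. of the statement that `Werner2009_lemma63_of_facts`
derives from the four facts; for the alternating event alone, Cor. 6.2 and the lower bound in the
proof of Lemma 6.2 rest on the Russo–Seymour–Welsh bounds below `L(p)` and the arm separation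
Prop. 6.1 only (Werner 2009, Lecture 6, §4: the separation lemmas "only used RSW estimates").

## References

* P. Nolin, Near-critical percolation in two dimensions, *Electron. J. Probab.* 13 (2008)
  1562–1623, §7.3, Prop. 34 and Remark 35; §4.5, Prop. 20; §6.1, Thm. 27 (arXiv 0711.4948:
  Prop. 32, Remark 34, Prop. 19, Thm. 26) [Nolin2008].
* H. Kesten, Scaling relations for 2D-percolation, *Comm. Math. Phys.* 109 (1987) 109–156, (4.5)
  [KestenScalingCMP1987].
* W. Werner, *Lectures on two-dimensional critical percolation*, IAS/Park City Math. Ser. 16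
  (2009), Lecture 6, Prop. 6.1, Cor. 6.2, Lemma 6.2, Cor. 6.3, Lemma 6.3 and the display
  following it (arXiv 0710.0856, pp. 44–47) [WernerPCMI2009].

Tree: `Nolin2008_prop34`, `charLength`, `critFourArmProb` (`KestenScaling.lean`),
`Nolin2008_prop34_of_wernerFacts` (`KestenScalingFromFacts.lean`), `Werner2009_lemma63_of_facts`
(`FourArmPivotalSumWerner.lean`), `Werner2009_fourArm_quasiMult`, `Werner2009_fourArm_lowerBound`
(`NearCriticalFourArmFacts.lean`), `Werner2009_halfPlane_twoArm`, `Werner2009_pivotal_lowerBound`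
(`NearCriticalBoundaryFacts.lean`). Mathlib: nothing beyond the imports of these files.
-/

noncomputable section

namespace Literature.Probability.Percolation

/-- **The upper Kesten bound `|p - 1/2| · L_ε(p)² · π₄(L_ε(p)) ≤ C` from two named facts**
(Nolin 2008, Remark 35 [arXiv 0711.4948: Remark 34]: the upper bound comes directly from Russo's
formula and the lower pivotal count; Werner 2009, Lecture 6, Cor. 6.3 with Lemma 6.3):
`Nolin2008_prop34_upper_of_facts` (`KestenScalingFromFacts.lean`: Russo's formula for the
`2N × N` parallelogram at `N = L_ε(p)`, the interior pivotal lower bound and the lower half of the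
four-arm stability) with the stability `Werner2009_lemma63` supplied by
`Werner2009_lemma63_of_facts`. For every `ε ∈ (0, 1/2)`: thresholds `r₁`, and for `r₀ ≥ r₁` a
`δ > 0` and `C` with `|p - 1/2| · L_ε(p)² · π₄(r₀, L_ε(p)) ≤ C` for `0 < |p - 1/2| < δ`. [cite: Nolin2008, §7.3, Remark 35 (arXiv 0711.4948: Remark 34)] [cite: WernerPCMI2009, Lecture 6, Cor. 6.3 and Lemma 6.3] -/
theorem Nolin2008_prop34_upper_of_facts4 (hQM : Werner2009_fourArm_quasiMult)
    (hLB : Werner2009_fourArm_lowerBound) (hHP : Werner2009_halfPlane_twoArm)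
    (hP : Werner2009_pivotal_lowerBound) ⦃ε : ℝ⦄ (hε : 0 < ε) (hε' : ε < 1 / 2) :
    ∃ r₁ : ℕ, ∀ r₀ ≥ r₁, ∃ δ > (0 : ℝ), ∃ C : ℝ,
      ∀ p : unitInterval, (p : ℝ) ≠ 1 / 2 → |(p : ℝ) - 1 / 2| < δ →
        |(p : ℝ) - 1 / 2| * (charLength ε p : ℝ) ^ 2 * critFourArmProb r₀ (charLength ε p) ≤ C :=
  Nolin2008_prop34_upper_of_facts (Werner2009_lemma63_of_facts hQM hLB hHP hP) hP hε hε'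

/-- **Kesten's scaling relation `|p - 1/2| · L_ε(p)² · π₄(L_ε(p)) ≍ 1` (`Nolin2008_prop34`) from
the four named facts of the near-critical arm calculus** (Nolin 2008, §7.3, Prop. 34
[arXiv 0711.4948: Prop. 32]; Kesten 1987, (4.5); Werner 2009, Lecture 6, display after
Lemma 6.3): `Werner2009_fourArm_quasiMult`, `Werner2009_fourArm_lowerBound`,
`Werner2009_halfPlane_twoArm` and `Werner2009_pivotal_lowerBound` imply `Nolin2008_prop34` —
`Nolin2008_prop34_of_wernerFacts` with its fifth hypothesis `Werner2009_lemma63` supplied by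
`Werner2009_lemma63_of_facts`. The discharge `Nolin2008_prop34_holds` is this theorem applied to
the four `_holds` once they land. [cite: Nolin2008, §7.3, Prop. 34 and Remark 35 (arXiv 0711.4948: Prop. 32, Remark 34)] [cite: KestenScalingCMP1987, (4.5)] [cite: WernerPCMI2009, Lecture 6, Cor. 6.3, Lemma 6.3 and the display following Lemma 6.3] -/
theorem Nolin2008_prop34_of_facts (hQM : Werner2009_fourArm_quasiMult)
    (hLB : Werner2009_fourArm_lowerBound) (hHP : Werner2009_halfPlane_twoArm)
    (hP : Werner2009_pivotal_lowerBound) : Nolin2008_prop34 :=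
  Nolin2008_prop34_of_wernerFacts (Werner2009_lemma63_of_facts hQM hLB hHP hP) hQM hLB hHP hP

end Literature.Probability.Percolation
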